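import Mathlib
import Literature.MathematicalPhysics.QuantumFieldTheory.Balaban1983to89.B6RandomWalk

/-!
# `Balaban1983to89.B9Thm314ResolventCore` — [Balaban1985BackgroundPropagators] Theorem 3.14 (pp. 426–427, (3.154)) by the RESOLVENT ROUTE,
# prefactor-free core over [4]'s block majorants: if `G′`, `G̃′` are inverses of `Δ′`, `Δ̃′` with exponentially decaying block majorants and `Δ̃′ − Δ′` is a
# local operator whose rows live on a block set `S` (⊂ Ωᶜ), then `G′ − G̃′ = G′(Δ̃′ − Δ′)G̃′` has the majorant `C·e^{−(δ/3)d(y,y′)}·e^{−(δ/3)F(y,y′)}` for every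
# `F` below the `S`-detour distance (e.g. (3.154)'s `d(y,y′,Ω)`), with `C = C₁vC₂c²` — constants of the INPUTS only (hence M-uniform when they are)

B9 = T. Bałaban, *Propagators for lattice gauge theories in a background field*, Commun. Math. Phys. **99** (1985) 389–434 [Balaban1985BackgroundPropagators];
[4] = [B6] = [Balaban1984PropagatorsII] ((2.51)–(2.55) p. 232: block majorants and their composition; Lemma 2.1 (2.61) p. 234).

THE PRINT (verbatim).  p. 427: *"This theorem can be proved in exactly the same way as the corresponding property in the theorem of [2]. We take random walk
expansions for both operators, and in the difference all terms for walks with localizations contained in Ω are cancelled. … Then the exponential factor in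
(3.108) gives the factor (3.154) (after adjusting a definition of δ₀)."*  (3.154): *"d(y, y′, Ω) = inf_{y₁∈Ωᶜ∩T^{(k)}}(|y − y₁| + |y₁ − y′|)"*.

WHY THIS FILE (DAG node N06, seat `pub-ymgap-dag-n06-a`, typed-leaf flag t314 PART (ii) — M-uniformity of the adjusted δ₀; dossier `N06-DOSSIER.md` §7 v1.4).
The typed leaf fields `t314`∕`t314loc` of `DagBinding.B9LeafX` read Theorem 3.14 with M-UNIFORM constant and rate; the printed WALK sketch delivers only an M-dependent
constant or rate (`B9Thm314.Thm314SupDep`, pv05: the localisation cubes have diameter ∼M).  The tree's own U = 1 theorem `B9Thm314GpFlatMultiLevelTorus.thm314_Gp_flat_multiLevelTorus`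
is nevertheless M-UNIFORM, because it uses the RESOLVENT IDENTITY `G′[D] − G′[D′] = G′[D](Δ′[D′] − Δ′[D])G′[D′]` (`B9Thm314GpFlatTorusGeometry.gmlT_sub_gmlT`,
`B9Thm314GpFlatResolvent.resolvent_bound`).  THIS MODULE ISOLATES THE CARRIER-FREE CORE OF THAT ROUTE over [4]'s block majorants (`B6RandomWalk.HasMajorant`): at any pin
the inputs are Theorem 3.1's sup majorants for the two operators (leaf t31 for both sequences — M-uniform by its own letter, p. 397), the locality of the difference of the
two (3.24) averaging operators (rows on the blocks where the two level functions differ, all outside Ω), and (2.61); the output is the sup entry of Theorem 3.14 with the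
factor e^{−(δ/3)d(y,y′,Ω)} and constants that are functions of the inputs only.  So the M-uniform typed reading is the reading the RESOLVENT proof supports; print's walk
sketch is a weaker proof of the same statement.

WHAT IS PROVED (kernel; no `sorry`; nothing of [B9] asserted — every analytic input is a displayed hypothesis of printed shape):
* §1 `sub_eq_mul_sub_mul` — the resolvent identity `t₁ − t₂ = t₁(a₂ − a₁)t₂` in any ring from `t₁a₁ = 1`, `a₂t₂ = 1`.
* §2 `hasMajorant_mul₃` — [4] (2.55): the majorant of a triple product is the double block-convolution of the three majorants.
* §3 `hasMajorant_resolvent_core` — THE ENGINE: majorants `K₁ ≤ C₁e^{−δd}`, `0 ≤ K₂ ≤ C₂e^{−δd}`, a middle factor with `K_V(y₁,y₂) ≤ v·e^{−2δd(y₁,y₂)}`, `K_V(y₁,·) = 0`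
  for `y₁ ∉ S`, the triangle inequality (2.54), `d ≥ 0`, the summability `Σ_{y′} e^{−(δ/3)d(y,y′)} ≤ c` ((2.61) at the rate δ/3) and ANY `F` with `F(y,y′) ≤ d(y,y₁) + d(y₁,y′)`
  for `y₁ ∈ S` ⇒ `T₁VT₂` has majorant `C₁vC₂c²·e^{−(δ/3)d(y,y′)}·e^{−(δ/3)F(y,y′)}`; `hasMajorant_inv_sub_inv_core` — the same for `T₁ − T₂` when `T₁a₁ = 1`, `a₂T₂ = 1`,
  `V = a₂ − a₁`.
HONEST SCOPE.  (a) PREFACTOR-FREE: the scale weights (Lʲη)², Lʲη, … of (3.42) are not carried (they move through [4] (2.60) exactly as in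
`B9Thm314GpFlatResolvent.transfer_top`; a weighted twin is the next item); (b) ONE block structure (both operators majorised on the blocks of {Ω_j}; the second family's
(2.67)-majorant must first be re-blocked — p21's `PhiMax`∕`PsiMax` device in `B9Thm314GpFlatResolvent`); (c) sup entries only (the L² ∕ Hölder members of `Thm314LocalPrinted`
follow the same pattern with their own majorant classes); (d) count-neutral; NOT continuum ∕ Clay.
-/

namespace Literature.MathematicalPhysics.QuantumFieldTheory.Balaban1983to89.B9Thm314ResolventCore

open Finset
open Literature.MathematicalPhysics.QuantumFieldTheory.Balaban1983to89.B6RandomWalk (HasMajorant hasMajorant_mono hasMajorant_mul Triangle254)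

/-! ## §1 The resolvent identity -/

/-- The resolvent identity: if `t₁` is a left inverse of `a₁` and `t₂` a right inverse of `a₂`, then `t₁ − t₂ = t₁(a₂ − a₁)t₂`.  (For `t₁ = G′[D] = (Δ′_a[D])⁻¹`,
`t₂ = G′[D′]`: `G′[D] − G′[D′] = G′[D](Δ′_a[D′] − Δ′_a[D])G′[D′]`.) [cite: Balaban1985BackgroundPropagators, (3.62) p.402 (the resolvent algebra of Sect. B, bookkeeping)] -/
theorem sub_eq_mul_sub_mul {R : Type*} [Ring R] {t₁ t₂ a₁ a₂ : R} (h₁ : t₁ * a₁ = 1) (h₂ : a₂ * t₂ = 1) :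
    t₁ - t₂ = t₁ * (a₂ - a₁) * t₂ := by
  rw [mul_sub, sub_mul, mul_assoc t₁ a₂ t₂, h₂, mul_one, h₁, one_mul]

/-! ## §2 The majorant of a triple product -/

section Majorants

variable {g : B6.Geometry} {X : Type}

/-- [4] (2.55) twice: the majorant of `T₁VT₂` is the double block-convolution `Σ_{y₁}Σ_{y₂} K₁(y,y₁)K_V(y₁,y₂)K₂(y₂,y′)` (for `K_V, K₂ ≥ 0`).
[cite: Balaban1984PropagatorsII, (2.52)–(2.55) p.232] -/
theorem hasMajorant_mul₃ (blk : X → g.Site) {T₁ V T₂ : Module.End ℝ (X → ℝ)} {K₁ KV K₂ : g.Site → g.Site → ℝ}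
    (h₁ : HasMajorant blk T₁ K₁) (hV : HasMajorant blk V KV) (h₂ : HasMajorant blk T₂ K₂) (hKV : ∀ a b, 0 ≤ KV a b)
    (hK₂ : ∀ a b, 0 ≤ K₂ a b) :
    HasMajorant blk (T₁ * V * T₂) (fun a b => ∑ y₁ : g.Site, ∑ y₂ : g.Site, K₁ a y₁ * KV y₁ y₂ * K₂ y₂ b) := by
  refine hasMajorant_mono blk (hasMajorant_mul blk (hasMajorant_mul blk h₁ hV hKV) h₂ hK₂) fun a b => le_of_eq ?_
  simp only [Finset.sum_mul]
  rw [Finset.sum_comm]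

/-! ## §3 The engine -/

/-- (2.61) at a weaker rate dominates the sum at a stronger one (for `d ≥ 0`). [cite: Balaban1984PropagatorsII, Lemma 2.1 (2.61) p.234 (bookkeeping)] -/
private theorem sum_exp_le_of_rate {σ δ c : ℝ} (hσδ : σ ≤ δ) (hd : ∀ a b : g.Site, 0 ≤ g.dist a b)
    (hsum : ∀ y : g.Site, ∑ y' : g.Site, Real.exp (-(σ * g.dist y y')) ≤ c) (y : g.Site) :
    ∑ y' : g.Site, Real.exp (-(δ * g.dist y y')) ≤ c := by
  refine le_trans (Finset.sum_le_sum fun y' _ => ?_) (hsum y)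
  exact Real.exp_le_exp.2 (neg_le_neg (mul_le_mul_of_nonneg_right hσδ (hd y y')))

/-- The inner summation of the engine: `Σ_{y₂} e^{−2δd(y₁,y₂)}e^{−δd(y₂,b)} ≤ c·e^{−δd(y₁,b)}` ((2.54) + (2.61)). [cite: Balaban1984PropagatorsII, (2.54)–(2.55) pp.232–233 (bookkeeping)] -/
private theorem inner_sum_le {δ c : ℝ} (hδ : 0 ≤ δ) (hd : ∀ a b : g.Site, 0 ≤ g.dist a b) (htri : Triangle254 g)
    (hsum : ∀ y : g.Site, ∑ y' : g.Site, Real.exp (-(δ / 3 * g.dist y y')) ≤ c) (y₁ b : g.Site) :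
    ∑ y₂ : g.Site, Real.exp (-(2 * δ * g.dist y₁ y₂)) * Real.exp (-(δ * g.dist y₂ b)) ≤
      c * Real.exp (-(δ * g.dist y₁ b)) := by
  have hterm : ∀ y₂ : g.Site, Real.exp (-(2 * δ * g.dist y₁ y₂)) * Real.exp (-(δ * g.dist y₂ b)) ≤
      Real.exp (-(δ * g.dist y₁ y₂)) * Real.exp (-(δ * g.dist y₁ b)) := by
    intro y₂
    rw [← Real.exp_add, ← Real.exp_add]
    apply Real.exp_le_exp.2
    have h3 := mul_le_mul_of_nonneg_left (htri y₁ y₂ b) hδ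
    nlinarith [hd y₁ y₂]
  calc ∑ y₂ : g.Site, Real.exp (-(2 * δ * g.dist y₁ y₂)) * Real.exp (-(δ * g.dist y₂ b))
      ≤ ∑ y₂ : g.Site, Real.exp (-(δ * g.dist y₁ y₂)) * Real.exp (-(δ * g.dist y₁ b)) := Finset.sum_le_sum fun y₂ _ => hterm y₂
    _ = (∑ y₂ : g.Site, Real.exp (-(δ * g.dist y₁ y₂))) * Real.exp (-(δ * g.dist y₁ b)) := by rw [Finset.sum_mul]
    _ ≤ c * Real.exp (-(δ * g.dist y₁ b)) :=
        mul_le_mul_of_nonneg_right (sum_exp_le_of_rate (by linarith) hd hsum y₁) (Real.exp_nonneg _)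

/-- **THE RESOLVENT ENGINE (prefactor-free core)** — see the module docstring.  Inputs: block majorants `K₁ ≤ C₁e^{−δd}` of `T₁` and `K₂ ≤ C₂e^{−δd}` of `T₂`
(Theorem 3.1-shape sup majorants of the two propagators), a middle factor `V` with majorant `K_V(y₁,y₂) ≤ v·e^{−2δd(y₁,y₂)}` vanishing for `y₁ ∉ S` (the difference of the
two (3.24) averaging operators: local, rows on the blocks outside Ω), the triangle inequality (2.54), `d ≥ 0`, (2.61) at the rate δ/3, and a function `F ≤` the `S`-detour distance
((3.154)'s `d(y,y′,Ω)`: `y₁ ∈ Ωᶜ ⇒ d(y,y′,Ω) ≤ |y − y₁| + |y₁ − y′|`).  Output: `T₁VT₂` has majorant `C₁vC₂c²·e^{−(δ/3)d(y,y′)}·e^{−(δ/3)F(y,y′)}`.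
[cite: Balaban1985BackgroundPropagators, Thm 3.14 (3.154) pp.426–427 (bookkeeping: the resolvent route); Balaban1984PropagatorsII, (2.54)–(2.55) pp.232–233 and (2.61) p.234] -/
theorem hasMajorant_resolvent_core (blk : X → g.Site) (hd : ∀ a b : g.Site, 0 ≤ g.dist a b) (htri : Triangle254 g)
    {δ c C₁ C₂ v : ℝ} (hδ : 0 ≤ δ) (hc : 0 ≤ c) (hC₁ : 0 ≤ C₁) (hC₂ : 0 ≤ C₂) (hv : 0 ≤ v)
    (hsum : ∀ y : g.Site, ∑ y' : g.Site, Real.exp (-(δ / 3 * g.dist y y')) ≤ c)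
    (S : Set g.Site) (F : g.Site → g.Site → ℝ) (hF : ∀ a b y₁ : g.Site, y₁ ∈ S → F a b ≤ g.dist a y₁ + g.dist y₁ b)
    {T₁ V T₂ : Module.End ℝ (X → ℝ)} {K₁ KV K₂ : g.Site → g.Site → ℝ}
    (h₁ : HasMajorant blk T₁ K₁) (hV : HasMajorant blk V KV) (h₂ : HasMajorant blk T₂ K₂)
    (hKV0 : ∀ a b, 0 ≤ KV a b) (hK₂0 : ∀ a b, 0 ≤ K₂ a b)
    (hK₁ : ∀ a y : g.Site, K₁ a y ≤ C₁ * Real.exp (-(δ * g.dist a y)))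
    (hKV : ∀ y₁ y₂ : g.Site, KV y₁ y₂ ≤ v * Real.exp (-(2 * δ * g.dist y₁ y₂)))
    (hKVS : ∀ y₁ y₂ : g.Site, y₁ ∉ S → KV y₁ y₂ = 0)
    (hK₂ : ∀ y b : g.Site, K₂ y b ≤ C₂ * Real.exp (-(δ * g.dist y b))) :
    HasMajorant blk (T₁ * V * T₂)
      (fun a b => C₁ * v * C₂ * c * c * Real.exp (-(δ / 3 * g.dist a b)) * Real.exp (-(δ / 3 * F a b))) := by
  refine hasMajorant_mono blk (hasMajorant_mul₃ blk h₁ hV h₂ hKV0 hK₂0) fun a b => ?_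
  -- the common factor of the final bound
  set E : ℝ := Real.exp (-(δ / 3 * g.dist a b)) * Real.exp (-(δ / 3 * F a b)) with hE
  have hE0 : 0 ≤ E := mul_nonneg (Real.exp_nonneg _) (Real.exp_nonneg _)
  have hCvc : 0 ≤ C₁ * v * C₂ * c := mul_nonneg (mul_nonneg (mul_nonneg hC₁ hv) hC₂) hc
  -- pointwise in the first intermediate block
  have step : ∀ y₁ : g.Site, ∑ y₂ : g.Site, K₁ a y₁ * KV y₁ y₂ * K₂ y₂ b ≤
      C₁ * v * C₂ * c * E * Real.exp (-(δ / 3 * g.dist a y₁)) := by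
    intro y₁
    by_cases hy : y₁ ∈ S
    · -- termwise bounds
      have t1 : ∀ y₂ : g.Site, K₁ a y₁ * KV y₁ y₂ * K₂ y₂ b ≤
          C₁ * Real.exp (-(δ * g.dist a y₁)) * (v * Real.exp (-(2 * δ * g.dist y₁ y₂))) *
            (C₂ * Real.exp (-(δ * g.dist y₂ b))) := fun y₂ =>
        mul_le_mul (mul_le_mul (hK₁ a y₁) (hKV y₁ y₂) (hKV0 _ _) (mul_nonneg hC₁ (Real.exp_nonneg _))) (hK₂ y₂ b) (hK₂0 _ _)
          (mul_nonneg (mul_nonneg hC₁ (Real.exp_nonneg _)) (mul_nonneg hv (Real.exp_nonneg _)))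
      have hsum₁ : ∑ y₂ : g.Site, K₁ a y₁ * KV y₁ y₂ * K₂ y₂ b ≤
          C₁ * Real.exp (-(δ * g.dist a y₁)) * v * C₂ *
            ∑ y₂ : g.Site, Real.exp (-(2 * δ * g.dist y₁ y₂)) * Real.exp (-(δ * g.dist y₂ b)) := by
        rw [Finset.mul_sum]
        refine Finset.sum_le_sum fun y₂ _ => (t1 y₂).trans (le_of_eq ?_)
        ring
      have hin := inner_sum_le hδ hd htri hsum y₁ b
      have hpre : 0 ≤ C₁ * Real.exp (-(δ * g.dist a y₁)) * v * C₂ :=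
        mul_nonneg (mul_nonneg (mul_nonneg hC₁ (Real.exp_nonneg _)) hv) hC₂
      -- the exponent bookkeeping: δ(d(a,y₁) + d(y₁,b)) ≥ (δ/3)(d(a,b) + F(a,b) + d(a,y₁))
      have hexp : Real.exp (-(δ * g.dist a y₁)) * Real.exp (-(δ * g.dist y₁ b)) ≤ E * Real.exp (-(δ / 3 * g.dist a y₁)) := by
        rw [hE, ← Real.exp_add, ← Real.exp_add, ← Real.exp_add]
        apply Real.exp_le_exp.2
        have hab := htri a y₁ b
        have hFab := hF a b y₁ hy
        have hq := hd y₁ b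
        have h3 : δ / 3 * (g.dist a b + F a b + g.dist a y₁) ≤ δ / 3 * (3 * (g.dist a y₁ + g.dist y₁ b)) :=
          mul_le_mul_of_nonneg_left (by linarith) (by linarith)
        linarith
      calc ∑ y₂ : g.Site, K₁ a y₁ * KV y₁ y₂ * K₂ y₂ b
          ≤ C₁ * Real.exp (-(δ * g.dist a y₁)) * v * C₂ * (c * Real.exp (-(δ * g.dist y₁ b))) :=
            hsum₁.trans (mul_le_mul_of_nonneg_left hin hpre)
        _ = C₁ * v * C₂ * c * (Real.exp (-(δ * g.dist a y₁)) * Real.exp (-(δ * g.dist y₁ b))) := by ring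
        _ ≤ C₁ * v * C₂ * c * (E * Real.exp (-(δ / 3 * g.dist a y₁))) := mul_le_mul_of_nonneg_left hexp hCvc
        _ = C₁ * v * C₂ * c * E * Real.exp (-(δ / 3 * g.dist a y₁)) := by ring
    · -- rows of `V` off `S` vanish
      have h0 : ∀ y₂ : g.Site, K₁ a y₁ * KV y₁ y₂ * K₂ y₂ b = 0 := fun y₂ => by rw [hKVS y₁ y₂ hy, mul_zero, zero_mul]
      simp only [h0, Finset.sum_const_zero]
      exact mul_nonneg (mul_nonneg hCvc hE0) (Real.exp_nonneg _)
  calc ∑ y₁ : g.Site, ∑ y₂ : g.Site, K₁ a y₁ * KV y₁ y₂ * K₂ y₂ b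
      ≤ ∑ y₁ : g.Site, C₁ * v * C₂ * c * E * Real.exp (-(δ / 3 * g.dist a y₁)) := Finset.sum_le_sum fun y₁ _ => step y₁
    _ = C₁ * v * C₂ * c * E * ∑ y₁ : g.Site, Real.exp (-(δ / 3 * g.dist a y₁)) := by rw [Finset.mul_sum]
    _ ≤ C₁ * v * C₂ * c * E * c := mul_le_mul_of_nonneg_left (hsum a) (mul_nonneg hCvc hE0)
    _ = C₁ * v * C₂ * c * c * Real.exp (-(δ / 3 * g.dist a b)) * Real.exp (-(δ / 3 * F a b)) := by rw [hE]; ring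

/-- **The resolvent route to Theorem 3.14's sup entry, prefactor-free**: for `T₁` a left inverse of `a₁` and `T₂` a right inverse of `a₂` (the two propagators and their
(finite-lattice) operators Δ′_a for the two sequences) and `V = a₂ − a₁` as in `hasMajorant_resolvent_core`, the DIFFERENCE `T₁ − T₂` has the majorant
`C₁vC₂c²·e^{−(δ/3)d(y,y′)}·e^{−(δ/3)F(y,y′)}` — the characteristic sup bound with the additional factor of (3.154), constants functions of the inputs only.
[cite: Balaban1985BackgroundPropagators, Thm 3.14 (3.154) pp.426–427 (bookkeeping: the resolvent route)] -/
theorem hasMajorant_inv_sub_inv_core (blk : X → g.Site) (hd : ∀ a b : g.Site, 0 ≤ g.dist a b) (htri : Triangle254 g)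
    {δ c C₁ C₂ v : ℝ} (hδ : 0 ≤ δ) (hc : 0 ≤ c) (hC₁ : 0 ≤ C₁) (hC₂ : 0 ≤ C₂) (hv : 0 ≤ v)
    (hsum : ∀ y : g.Site, ∑ y' : g.Site, Real.exp (-(δ / 3 * g.dist y y')) ≤ c)
    (S : Set g.Site) (F : g.Site → g.Site → ℝ) (hF : ∀ a b y₁ : g.Site, y₁ ∈ S → F a b ≤ g.dist a y₁ + g.dist y₁ b)
    {T₁ T₂ A₁ A₂ : Module.End ℝ (X → ℝ)} (hinv₁ : T₁ * A₁ = 1) (hinv₂ : A₂ * T₂ = 1) {K₁ KV K₂ : g.Site → g.Site → ℝ}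
    (h₁ : HasMajorant blk T₁ K₁) (hV : HasMajorant blk (A₂ - A₁) KV) (h₂ : HasMajorant blk T₂ K₂)
    (hKV0 : ∀ a b, 0 ≤ KV a b) (hK₂0 : ∀ a b, 0 ≤ K₂ a b)
    (hK₁ : ∀ a y : g.Site, K₁ a y ≤ C₁ * Real.exp (-(δ * g.dist a y)))
    (hKV : ∀ y₁ y₂ : g.Site, KV y₁ y₂ ≤ v * Real.exp (-(2 * δ * g.dist y₁ y₂)))
    (hKVS : ∀ y₁ y₂ : g.Site, y₁ ∉ S → KV y₁ y₂ = 0)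
    (hK₂ : ∀ y b : g.Site, K₂ y b ≤ C₂ * Real.exp (-(δ * g.dist y b))) :
    HasMajorant blk (T₁ - T₂)
      (fun a b => C₁ * v * C₂ * c * c * Real.exp (-(δ / 3 * g.dist a b)) * Real.exp (-(δ / 3 * F a b))) := by
  rw [sub_eq_mul_sub_mul hinv₁ hinv₂]
  exact hasMajorant_resolvent_core blk hd htri hδ hc hC₁ hC₂ hv hsum S F hF h₁ hV h₂ hKV0 hK₂0 hK₁ hKV hKVS hK₂

end Majorants

end Literature.MathematicalPhysics.QuantumFieldTheory.Balaban1983to89.B9Thm314ResolventCore
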